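import Summits.CriticalPhenomena.PercolationContinuityZ3.Theorems.PercNearOneGluingNoHeavyQuantTwoBigCellHHC1
import Summits.CriticalPhenomena.PercolationContinuityZ3.Theorems.PercNearOneGluingNoHeavyQuantTwoBigCellHHC2
import Summits.CriticalPhenomena.PercolationContinuityZ3.Theorems.PercNearOneGluingNoHeavyQuantTwoBigCellHHC3
import Summits.CriticalPhenomena.PercolationContinuityZ3.Theorems.PercNearOneGluingNoHeavyQuantTwoBigCellHHC4
import Summits.CriticalPhenomena.PercolationContinuityZ3.Theorems.PercNearOneGluingNoHeavyQuantTwoBigConvert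
import HarnessLib

/-!
# QUANT lane R8, Conjecture DIB\* — the two-big certificate, part 3: type pair `HH`

builds on p205010 (kernel theorem, internal audit signed; external expert review pending)

Support file (`--supports stmt-CriticalPhenomena-4575`), QUANT lane census-1 (gen 17); memo
`run/shared/lean/prim/quant/prim-quant-census-1/TWOBIG-G17.md`.  Theorems only, no definitions, no sorries, standard axioms.
The four cell lemmas `tbcCell_HH_C1..C4` are dispatched on `c̃ ≥ 1`, `c̃ ≤ (1+x)λ₁`, `c̃ ≤ (1+x)λ₂`, and converted (`tbc_convert`)
to the certificate form `1 − y ≤ p₁p₂ + p₁q₂z₁ + q₁p₂z₂ + q₁q₂z₀` (a four-way disjunction recording which items were used).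
[this work]; the gluing rows served [cite: KozmaNitzan2024, Conjecture 3 (p. 15)].
-/

namespace Summit.CriticalPhenomena.PercolationContinuityZ3.Theorems

namespace Quant

namespace IndepBlob

/-- **Type pair `HH`** (big 1 heavy, big 2 heavy): dispatch on the cells `c̃ ≥ 1` / `c̃ ≤ (1+x)λ₁` / `c̃ ≤ (1+x)λ₂` / else, and conversion
to the certificate form. [this work] -/
theorem tbcType_HH (y u₁ v₁ u₂ v₂ p₁ p₂ zC₁ zM₁ zC₂ zM₂ zC₀ : ℝ) (hy0 : 0 < y) (hhy : y ≤ 1 / 2) (hu1 : 0 ≤ u₁) (hv1 : 0 ≤ v₁) (hu2 : 0 ≤ u₂)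
    (hv2 : 0 ≤ v₂) (ha1 : u₁ + v₁ ≤ 1) (hb1 : 1 / 2 ≤ u₁ + v₁) (ha2 : u₂ + v₂ ≤ 1) (hb2 : 1 / 2 ≤ u₂ + v₂) (ht1 : 0 ≤ u₁ * y - (1 - y) * v₁)
    (ht2 : 0 ≤ u₂ * y - (1 - y) * v₂) (hct : 0 < (2 - u₁ - u₂)) (hP1 : (u₁ + v₁) * p₁ = u₁) (hP2 : (u₂ + v₂) * p₂ = u₂)
    (hC1 : (1 + v₁ - u₂) ^ 2 ≤ zC₁ * (y * (2 - u₁ - u₂) + (1 + v₁ - u₂) ^ 2))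
    (hC2 : (1 + v₂ - u₁) ^ 2 ≤ zC₂ * (y * (2 - u₁ - u₂) + (1 + v₂ - u₁) ^ 2))
    (hM1 : 0 ≤ (2 - y) * (1 - u₁ - v₁) - (2 - u₁ - u₂) → ((1 - y) * (1 + v₁ - u₂)) ≤ zM₁ * ((2 - u₁ - u₂) - (1 - y) * (1 - u₁ - v₁)))
    (hM2 : 0 ≤ (2 - y) * (1 - u₂ - v₂) - (2 - u₁ - u₂) → ((1 - y) * (1 + v₂ - u₁)) ≤ zM₂ * ((2 - u₁ - u₂) - (1 - y) * (1 - u₂ - v₂)))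
    (hC0 : 0 ≤ (2 - u₁ - u₂) - 1 → (1 - u₁ - u₂) ^ 2 ≤ zC₀ * (y * (2 - u₁ - u₂) + (1 - u₁ - u₂) ^ 2)) :
    (0 ≤ (2 - u₁ - u₂) - 1 ∧ 1 - y ≤ p₁ * p₂ + p₁ * (1 - p₂) * zC₁ + (1 - p₁) * p₂ * zC₂ + (1 - p₁) * (1 - p₂) * zC₀) ∨
      (1 - y ≤ p₁ * p₂ + p₁ * (1 - p₂) * zC₁ + (1 - p₁) * p₂ * zC₂ + (1 - p₁) * (1 - p₂) * 0) ∨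
      (1 - y ≤ p₁ * p₂ + p₁ * (1 - p₂) * zM₁ + (1 - p₁) * p₂ * zC₂ + (1 - p₁) * (1 - p₂) * 0) ∨
      (1 - y ≤ p₁ * p₂ + p₁ * (1 - p₂) * zC₁ + (1 - p₁) * p₂ * zM₂ + (1 - p₁) * (1 - p₂) * 0) := by
  have hQ1 : (u₁ + v₁) * (1 - p₁) = v₁ := by linarith [hP1]
  have hQ2 : (u₂ + v₂) * (1 - p₂) = v₂ := by linarith [hP2]
  have hA1 : (0 : ℝ) < u₁ + v₁ := by linarith
  have hA2 : (0 : ℝ) < u₂ + v₂ := by linarith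
  by_cases hc : (0 : ℝ) ≤ (2 - u₁ - u₂) - 1
  · have cell := tbcCell_HH_C1 y u₁ v₁ u₂ v₂ zC₁ zC₂ zC₀ hy0 hhy hu1 hv1 hu2 hv2 ha1 hb1 ha2 hb2 ht1 ht2 hc hct hC1 hC2 (hC0 hc)
    exact Or.inl ⟨hc, tbc_convert y (u₁ + v₁) (u₂ + v₂) p₁ p₂ _ _ _ _ zC₁ zC₂ zC₀ hA1 hA2 hP1 hQ1 hP2 hQ2 cell⟩
  · have hc' : (0 : ℝ) ≤ 1 - (2 - u₁ - u₂) := by linarith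
    by_cases hr1 : (0 : ℝ) ≤ (2 - y) * (1 - u₁ - v₁) - (2 - u₁ - u₂)
    · have cell := tbcCell_HH_C3 y u₁ v₁ u₂ v₂ zM₁ zC₂ 0 hy0 hhy hu1 hv1 hu2 hv2 ha1 hb1 ha2 hb2 ht1 ht2 hr1 hct (hM1 hr1) hC2 le_rfl
      exact Or.inr (Or.inr (Or.inl (tbc_convert y (u₁ + v₁) (u₂ + v₂) p₁ p₂ _ _ _ _ zM₁ zC₂ 0 hA1 hA2 hP1 hQ1 hP2 hQ2 cell)))
    · by_cases hr2 : (0 : ℝ) ≤ (2 - y) * (1 - u₂ - v₂) - (2 - u₁ - u₂)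
      · have cell := tbcCell_HH_C4 y u₁ v₁ u₂ v₂ zC₁ zM₂ 0 hy0 hhy hu1 hv1 hu2 hv2 ha1 hb1 ha2 hb2 ht1 ht2 hr2 hct hC1 (hM2 hr2) le_rfl
        exact Or.inr (Or.inr (Or.inr (tbc_convert y (u₁ + v₁) (u₂ + v₂) p₁ p₂ _ _ _ _ zC₁ zM₂ 0 hA1 hA2 hP1 hQ1 hP2 hQ2 cell)))
      · have hr1' : (0 : ℝ) ≤ (2 - u₁ - u₂) - (2 - y) * (1 - u₁ - v₁) := by linarith
        have hr2' : (0 : ℝ) ≤ (2 - u₁ - u₂) - (2 - y) * (1 - u₂ - v₂) := by linarith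
        have cell := tbcCell_HH_C2 y u₁ v₁ u₂ v₂ zC₁ zC₂ 0 hy0 hhy hu1 hv1 hu2 hv2 ha1 hb1 ha2 hb2 ht1 ht2 hc' hr1' hr2' hct hC1 hC2 le_rfl
        exact Or.inr (Or.inl (tbc_convert y (u₁ + v₁) (u₂ + v₂) p₁ p₂ _ _ _ _ zC₁ zC₂ 0 hA1 hA2 hP1 hQ1 hP2 hQ2 cell))

end IndepBlob

end Quant

end Summit.CriticalPhenomena.PercolationContinuityZ3.Theorems
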